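import Literature.Analysis.FluidPDE.AdaptedBackwardKernel
import Literature.Analysis.FluidPDE.LerayHopf
import Literature.Analysis.FluidPDE.LocalBiotSavart
import Literature.Analysis.FluidPDE.TaoY6Poincare
import Literature.Analysis.FluidPDE.TaoLocalisationHolds

/-! # Lower pinching of the adapted enstrophy: analytic tools — crux stmt-NavierStokesRegularity-10493
(`AdaptedFrequency.AdaptedFrequencyConverges`), line tauberian-omega-limit, stub `stub_pinchingLower`

Helper file (theorems only) for the stub `stub_pinchingLower` of line `tauberian-omega-limit`
(lower pinching `0 < c₀ ≤ (T−t)² H(t)` of the adapted enstrophy `H(t) = ∫ ‖curl u(t)‖² G(t)` at a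
Type-I backward-singular point). Everything here is elementary analysis at ONE time slice
`v = u(t)`, at the similarity scale `λ = √(T−t)`:

* `pinchingLower_sq_dist_average_le` — a smooth divergence-free field with `‖v‖ ≤ s` is `L²`-close
  on `B(c, ρ)` to its mean: `∫_{B(c,ρ)} ‖v − v_B‖² ≤ 64ρ² (486(1+M²) ∫_{B(c,3r)} ‖curl v‖² +
  |B(c,ρ)| (3C₁ s/r)²)`, `ρ ≤ r` — Tao's local Biot–Savart law (`local_biotSavart_bound`,
  Tao 2013 §10) and the Poincaré inequality on balls (`TaoY6.setIntegral_sq_norm_sub_setAverage_le`);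
* `pinchingLower_sq_norm_mul_measureReal_le`, `pinchingLower_cube_integral_le` — the mean is
  controlled by the local energy, the cubic integral by the sup norm, the mean and the oscillation;
* `pinchingLower_ball_enstrophy_le` — Gaussian lower comparability of the kernel turns `H(t)` into a
  bound for the local enstrophy `∫_{B(x₀, a√(T−t))} ‖curl u(t)‖²`;
* `pinchingLower_integrable_enstrophy_mul` — the weighted enstrophy of a classical Leray–Hopf
  solution from a rapidly decaying datum is finite at every `0 < t < T` (Tao 2013, Sobolev bounds
  on closed slabs, `tao2011_hasBoundedSobolevNormsOn_holds`), so `H(t)` is never Bochner junk;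
* `pinchingLower_key_estimate` — the one-time estimate combining the above with a Morrey bound and
  an `L³` lower bound: `γ < 4Cρ_c³M/b² + 6C(64·486(1+M_reg²) b²λW + 576|B₁|C₁²C² b⁵/a²)`.

Sources: T. Tao, Anal. PDE 6 (2013) = arXiv:1108.1165, §10 (local Biot–Savart law); L. C. Evans,
PDE, §5.8.1 (Poincaré); the main file `…StubPinchingLower.lean` assembles the contradiction with
Barker–Prange 2020, Thm. 2.
-/

noncomputable section

open scoped Topology InnerProductSpace RealInnerProductSpace ENNReal
open Literature.Analysis.FluidPDE Set Filter MeasureTheory Metric Function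

namespace Summit.NavierStokesRegularity.NavierStokesRegularity.Theorems.AdaptedFrequencyConverges.TauberianOmegaLimit

/-! ### Analysis on a ball: a bounded divergence-free field with small local enstrophy is
`L²`-close to its mean -/

/-- **Near-constancy in `L²` on a ball.** For `v ∈ C^∞(ℝ³; ℝ³)` divergence free with `‖v‖ ≤ s`
everywhere, a centre `c` and radii `0 < ρ ≤ r`:
`∫_{B(c,ρ)} ‖v − v_{B(c,ρ)}‖² ≤ 64 ρ² (486 (1 + M²) ∫_{B(c,3r)} ‖curl v‖² + |B(c,ρ)| (3 C₁ s / r)²)`,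
`v_{B} = ⨍_B v`, `M = regLaplacianMass`, `C₁ = lamGradL1` (Poincaré on the ball,
`TaoY6.setIntegral_sq_norm_sub_setAverage_le`, and Tao's local Biot–Savart bound
`‖Dv‖ ≤ F + 3 C₁ s / r` on `B(c, r)` with `∫ F² ≤ 486 (1 + M²) ∫_{B(c,3r)} ‖curl v‖²`,
`local_biotSavart_bound`). [cite: Tao2011, §10, proof of Thm. 10.1 (p. 32)] -/
theorem pinchingLower_sq_dist_average_le
    {v : EuclideanSpace ℝ (Fin 3) → EuclideanSpace ℝ (Fin 3)} (hv : ContDiff ℝ (⊤ : ℕ∞) v)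
    (hdiv : VectorCalculus.IsDivFree v) {s : ℝ} (hs : ∀ y, ‖v y‖ ≤ s)
    (c : EuclideanSpace ℝ (Fin 3)) {ρ r : ℝ} (hρ : 0 < ρ) (hρr : ρ ≤ r) :
    ∫ x in ball c ρ, ‖v x - ⨍ y in ball c ρ, v y‖ ^ 2 ≤
      64 * ρ ^ 2 * (486 * (1 + regLaplacianMass ^ 2) * (∫ y in ball c (3 * r), ‖curl v y‖ ^ 2) +
        volume.real (ball c ρ) * (3 * lamGradL1 * r⁻¹ * s) ^ 2) := by
  have hr : 0 < r := lt_of_lt_of_le hρ hρr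
  obtain ⟨F, hFc, -, hFi, hFle, -, hFs⟩ := local_biotSavart_bound hv hdiv c hr
  set L : ℝ := 3 * lamGradL1 * r⁻¹ * s with hL
  have hDle : ∀ x ∈ ball c ρ, ‖fderiv ℝ v x‖ ≤ F x + L := fun x hx =>
    hFs s hs x (ball_subset_ball hρr hx)
  -- Poincaré on the ball
  have hv1 : ContDiff ℝ 1 v := hv.of_le (by exact_mod_cast le_top)
  have hB0 : volume (ball c ρ) ≠ 0 := (measure_ball_pos volume c hρ).ne'
  have hBreal : volume.real (ball c ρ) ≠ 0 := by
    rw [measureReal_def]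
    exact ENNReal.toReal_ne_zero.2 ⟨hB0, measure_ball_lt_top.ne⟩
  have hP := TaoY6.setIntegral_sq_norm_sub_setAverage_le (μ := volume) hv1 isOpen_ball isBounded_ball
    measurableSet_ball (Subset.refl (ball c ρ))
    (fun x hx y hy => (convex_ball c ρ).segment_subset hx hy) (δ := 2 * ρ) (by positivity)
    (fun x hx y hy => by
      rw [mem_ball, dist_eq_norm] at hx hy
      calc ‖y - x‖ = ‖(y - c) - (x - c)‖ := by abel_nf
        _ ≤ ‖y - c‖ + ‖x - c‖ := norm_sub_le _ _
        _ ≤ 2 * ρ := by linarith) hB0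
  rw [div_self hBreal, mul_one, finrank_euclideanSpace_fin] at hP
  -- the gradient energy on the ball
  have hDc : Continuous fun x => ‖fderiv ℝ v x‖ ^ 2 :=
    ((hv1.continuous_fderiv one_ne_zero).norm).pow 2
  have hFL : Continuous fun x => 2 * F x ^ 2 + 2 * L ^ 2 := by fun_prop
  have hI1 : IntegrableOn (fun x => ‖fderiv ℝ v x‖ ^ 2) (ball c ρ) volume :=
    TaoY6.integrableOn_of_continuous_of_isBounded hDc isBounded_ball
  have hI2 : IntegrableOn (fun x => 2 * F x ^ 2 + 2 * L ^ 2) (ball c ρ) volume :=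
    TaoY6.integrableOn_of_continuous_of_isBounded hFL isBounded_ball
  have hgrad : ∫ x in ball c ρ, ‖fderiv ℝ v x‖ ^ 2 ≤
      2 * (∫ x, F x ^ 2) + 2 * L ^ 2 * volume.real (ball c ρ) := by
    calc ∫ x in ball c ρ, ‖fderiv ℝ v x‖ ^ 2 ≤ ∫ x in ball c ρ, (2 * F x ^ 2 + 2 * L ^ 2) := by
          refine setIntegral_mono_on hI1 hI2 measurableSet_ball fun x hx => ?_
          have h1 : ‖fderiv ℝ v x‖ ^ 2 ≤ (F x + L) ^ 2 :=
            pow_le_pow_left₀ (norm_nonneg _) (hDle x hx) 2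
          nlinarith [sq_nonneg (F x - L)]
      _ = 2 * (∫ x in ball c ρ, F x ^ 2) + 2 * L ^ 2 * volume.real (ball c ρ) := by
          rw [integral_add ((hFi.const_mul 2).integrableOn) (integrableOn_const measure_ball_lt_top.ne),
            integral_const_mul, setIntegral_const, smul_eq_mul]
          ring
      _ ≤ 2 * (∫ x, F x ^ 2) + 2 * L ^ 2 * volume.real (ball c ρ) := by
          have := setIntegral_le_integral (s := ball c ρ) hFi (Eventually.of_forall fun x => sq_nonneg (F x))
          linarith
  -- assemble
  calc ∫ x in ball c ρ, ‖v x - ⨍ y in ball c ρ, v y‖ ^ 2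
      ≤ 2 ^ 3 * (2 * ρ) ^ 2 * ∫ x in ball c ρ, ‖fderiv ℝ v x‖ ^ 2 := hP
    _ ≤ 2 ^ 3 * (2 * ρ) ^ 2 * (2 * (∫ x, F x ^ 2) + 2 * L ^ 2 * volume.real (ball c ρ)) := by gcongr
    _ ≤ 2 ^ 3 * (2 * ρ) ^ 2 * (2 * (486 * (1 + regLaplacianMass ^ 2) *
          (∫ y in ball c (3 * r), ‖curl v y‖ ^ 2)) + 2 * L ^ 2 * volume.real (ball c ρ)) := by gcongr
    _ = _ := by rw [hL]; ring

/-- **The mean of a field on a ball is controlled by its local energy and its oscillation**: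
`‖m‖² |B| ≤ 2 ∫_B ‖v‖² + 2 ∫_B ‖v − m‖²` for every continuous `v`, ball `B` and vector `m`
(pointwise `‖m‖ ≤ ‖v‖ + ‖v − m‖`). [folklore] -/
theorem pinchingLower_sq_norm_mul_measureReal_le
    {v : EuclideanSpace ℝ (Fin 3) → EuclideanSpace ℝ (Fin 3)} (hv : Continuous v)
    (c : EuclideanSpace ℝ (Fin 3)) (ρ : ℝ) (m : EuclideanSpace ℝ (Fin 3)) :
    ‖m‖ ^ 2 * volume.real (ball c ρ) ≤
      2 * (∫ x in ball c ρ, ‖v x‖ ^ 2) + 2 * ∫ x in ball c ρ, ‖v x - m‖ ^ 2 := by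
  have hI1 : IntegrableOn (fun x => ‖v x‖ ^ 2) (ball c ρ) volume :=
    TaoY6.integrableOn_of_continuous_of_isBounded (hv.norm.pow 2) isBounded_ball
  have hI2 : IntegrableOn (fun x => ‖v x - m‖ ^ 2) (ball c ρ) volume :=
    TaoY6.integrableOn_of_continuous_of_isBounded ((hv.sub continuous_const).norm.pow 2) isBounded_ball
  calc ‖m‖ ^ 2 * volume.real (ball c ρ) = ∫ _ in ball c ρ, ‖m‖ ^ 2 := by
        rw [setIntegral_const, smul_eq_mul, mul_comm]
    _ ≤ ∫ x in ball c ρ, (2 * ‖v x‖ ^ 2 + 2 * ‖v x - m‖ ^ 2) := by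
        refine setIntegral_mono_on (integrableOn_const measure_ball_lt_top.ne)
          ((hI1.const_mul 2).add (hI2.const_mul 2)) measurableSet_ball fun x _ => ?_
        have h1 : ‖m‖ ≤ ‖v x‖ + ‖v x - m‖ := by
          calc ‖m‖ = ‖v x - (v x - m)‖ := by rw [sub_sub_cancel]
            _ ≤ ‖v x‖ + ‖v x - m‖ := norm_sub_le _ _
        nlinarith [norm_nonneg m, norm_nonneg (v x), norm_nonneg (v x - m),
          sq_nonneg (‖v x‖ - ‖v x - m‖)]
    _ = 2 * (∫ x in ball c ρ, ‖v x‖ ^ 2) + 2 * ∫ x in ball c ρ, ‖v x - m‖ ^ 2 := by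
        rw [integral_add (hI1.const_mul 2) (hI2.const_mul 2), integral_const_mul, integral_const_mul]

/-- **The cubic integral on a small ball**: if `‖v‖ ≤ s` then for `ρ' ≤ ρ` and every vector `m`,
`∫_{B(c,ρ')} ‖v‖³ ≤ s (2 ‖m‖² |B(c,ρ')| + 2 ∫_{B(c,ρ)} ‖v − m‖²)`. [folklore] -/
theorem pinchingLower_cube_integral_le
    {v : EuclideanSpace ℝ (Fin 3) → EuclideanSpace ℝ (Fin 3)} (hv : Continuous v) {s : ℝ}
    (hs : ∀ y, ‖v y‖ ≤ s) (c : EuclideanSpace ℝ (Fin 3)) {ρ' ρ : ℝ} (hρ' : ρ' ≤ ρ)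
    (m : EuclideanSpace ℝ (Fin 3)) :
    ∫ x in ball c ρ', ‖v x‖ ^ 3 ≤
      s * (2 * ‖m‖ ^ 2 * volume.real (ball c ρ') + 2 * ∫ x in ball c ρ, ‖v x - m‖ ^ 2) := by
  have hs0 : 0 ≤ s := (norm_nonneg _).trans (hs c)
  have hI1 : ∀ R, IntegrableOn (fun x => ‖v x‖ ^ 2) (ball c R) volume := fun R =>
    TaoY6.integrableOn_of_continuous_of_isBounded (hv.norm.pow 2) isBounded_ball
  have hI2 : ∀ R, IntegrableOn (fun x => ‖v x - m‖ ^ 2) (ball c R) volume := fun R =>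
    TaoY6.integrableOn_of_continuous_of_isBounded ((hv.sub continuous_const).norm.pow 2) isBounded_ball
  have hI3 : IntegrableOn (fun x => ‖v x‖ ^ 3) (ball c ρ') volume :=
    TaoY6.integrableOn_of_continuous_of_isBounded (hv.norm.pow 3) isBounded_ball
  have h1 : ∫ x in ball c ρ', ‖v x‖ ^ 3 ≤ s * ∫ x in ball c ρ', ‖v x‖ ^ 2 := by
    rw [← integral_const_mul]
    refine setIntegral_mono_on hI3 ((hI1 ρ').const_mul s) measurableSet_ball fun x _ => ?_
    calc ‖v x‖ ^ 3 = ‖v x‖ * ‖v x‖ ^ 2 := by ring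
      _ ≤ s * ‖v x‖ ^ 2 := mul_le_mul_of_nonneg_right (hs x) (sq_nonneg _)
  have h2 : ∫ x in ball c ρ', ‖v x‖ ^ 2 ≤
      ‖m‖ ^ 2 * volume.real (ball c ρ') * 2 + 2 * ∫ x in ball c ρ', ‖v x - m‖ ^ 2 := by
    calc ∫ x in ball c ρ', ‖v x‖ ^ 2 ≤ ∫ x in ball c ρ', (2 * ‖m‖ ^ 2 + 2 * ‖v x - m‖ ^ 2) := by
          have hc : IntegrableOn (fun _ : EuclideanSpace ℝ (Fin 3) => 2 * ‖m‖ ^ 2) (ball c ρ') volume :=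
            integrableOn_const measure_ball_lt_top.ne
          refine setIntegral_mono_on (hI1 ρ') (hc.add ((hI2 ρ').const_mul 2)) measurableSet_ball
            fun x _ => ?_
          have h1 : ‖v x‖ ≤ ‖m‖ + ‖v x - m‖ := by
            calc ‖v x‖ = ‖m + (v x - m)‖ := by rw [add_sub_cancel]
              _ ≤ ‖m‖ + ‖v x - m‖ := norm_add_le _ _
          nlinarith [norm_nonneg m, norm_nonneg (v x), norm_nonneg (v x - m),
            sq_nonneg (‖m‖ - ‖v x - m‖)]
      _ = ‖m‖ ^ 2 * volume.real (ball c ρ') * 2 + 2 * ∫ x in ball c ρ', ‖v x - m‖ ^ 2 := by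
          have hc : IntegrableOn (fun _ : EuclideanSpace ℝ (Fin 3) => 2 * ‖m‖ ^ 2) (ball c ρ') volume :=
            integrableOn_const measure_ball_lt_top.ne
          rw [integral_add hc ((hI2 ρ').const_mul 2), integral_const_mul, integral_const_mul,
            setIntegral_const, smul_eq_mul]
          ring
  have h3 : ∫ x in ball c ρ', ‖v x - m‖ ^ 2 ≤ ∫ x in ball c ρ, ‖v x - m‖ ^ 2 :=
    setIntegral_mono_set (hI2 ρ) (Eventually.of_forall fun x => sq_nonneg _)
      (Eventually.of_forall (ball_subset_ball hρ'))
  calc ∫ x in ball c ρ', ‖v x‖ ^ 3 ≤ s * ∫ x in ball c ρ', ‖v x‖ ^ 2 := h1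
    _ ≤ s * (‖m‖ ^ 2 * volume.real (ball c ρ') * 2 + 2 * ∫ x in ball c ρ', ‖v x - m‖ ^ 2) := by gcongr
    _ ≤ s * (2 * ‖m‖ ^ 2 * volume.real (ball c ρ') + 2 * ∫ x in ball c ρ, ‖v x - m‖ ^ 2) := by
        gcongr s * ?_
        linarith

/-! ### The adapted enstrophy controls the local enstrophy at the similarity scale -/

/-- **Gaussian lower comparability ⇒ local enstrophy bound.** If
`G(t, x) ≥ c₁ (T−t)^{-3/2} exp(−‖x−x₀‖²/(c₂(T−t)))` and `‖curl u(t)‖² G(t)` is integrable, then for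
every `a`:
`∫_{B(x₀, a√(T−t))} ‖curl u(t)‖² ≤ c₁⁻¹ e^{a²/c₂} (T−t)^{3/2} H(t)`, `H = adaptedEnstrophy u G`
(on that ball the kernel is `≥ c₁ (T−t)^{-3/2} e^{-a²/c₂}`). The integrability hypothesis is
essential: without it `H(t)` is the Bochner junk value `0`. [folklore] -/
theorem pinchingLower_ball_enstrophy_le
    {u : ℝ → EuclideanSpace ℝ (Fin 3) → EuclideanSpace ℝ (Fin 3)}
    {G : ℝ → EuclideanSpace ℝ (Fin 3) → ℝ} {T t c₁ c₂ : ℝ} {x₀ : EuclideanSpace ℝ (Fin 3)}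
    (hc₁ : 0 < c₁) (hc₂ : 0 < c₂) (ht : t < T)
    (hG : ∀ x, c₁ * (T - t) ^ (-(3:ℝ) / 2) * Real.exp (-(‖x - x₀‖ ^ 2) / (c₂ * (T - t))) ≤ G t x)
    (hω : Continuous (curl (u t)))
    (hint : Integrable (fun x => ‖curl (u t) x‖ ^ 2 * G t x)) (a : ℝ) :
    ∫ x in ball x₀ (a * Real.sqrt (T - t)), ‖curl (u t) x‖ ^ 2 ≤
      c₁⁻¹ * Real.exp (a ^ 2 / c₂) * (T - t) ^ ((3:ℝ) / 2) * adaptedEnstrophy u G t := by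
  have hTt : 0 < T - t := sub_pos.2 ht
  set g₀ : ℝ := c₁ * (T - t) ^ (-(3:ℝ) / 2) * Real.exp (-(a ^ 2 / c₂)) with hg₀
  have hg₀pos : 0 < g₀ := by positivity
  -- on the ball the kernel is at least `g₀`
  have hGball : ∀ x ∈ ball x₀ (a * Real.sqrt (T - t)), g₀ ≤ G t x := by
    intro x hx
    refine le_trans ?_ (hG x)
    rw [hg₀]
    refine mul_le_mul_of_nonneg_left (Real.exp_le_exp.2 ?_) (by positivity)
    rw [mem_ball, dist_eq_norm] at hx
    have h1 : ‖x - x₀‖ ^ 2 < (a * Real.sqrt (T - t)) ^ 2 :=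
      pow_lt_pow_left₀ hx (norm_nonneg _) two_ne_zero
    rw [mul_pow, Real.sq_sqrt hTt.le] at h1
    rw [neg_div, neg_le_neg_iff, div_le_div_iff₀ (by positivity) hc₂]
    nlinarith
  have hGnn : ∀ x, 0 ≤ G t x := fun x => le_trans (by positivity) (hG x)
  have hI : IntegrableOn (fun x => ‖curl (u t) x‖ ^ 2) (ball x₀ (a * Real.sqrt (T - t))) volume :=
    TaoY6.integrableOn_of_continuous_of_isBounded (hω.norm.pow 2) isBounded_ball
  have hg₀inv : g₀⁻¹ = c₁⁻¹ * Real.exp (a ^ 2 / c₂) * (T - t) ^ ((3:ℝ) / 2) := by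
    rw [hg₀, show (-(3:ℝ) / 2) = -((3:ℝ) / 2) by ring, Real.rpow_neg hTt.le, Real.exp_neg]
    have h1 : 0 < (T - t) ^ ((3:ℝ) / 2) := Real.rpow_pos_of_pos hTt _
    field_simp
  calc ∫ x in ball x₀ (a * Real.sqrt (T - t)), ‖curl (u t) x‖ ^ 2
      = g₀⁻¹ * ∫ x in ball x₀ (a * Real.sqrt (T - t)), g₀ * ‖curl (u t) x‖ ^ 2 := by
        rw [integral_const_mul, ← mul_assoc, inv_mul_cancel₀ hg₀pos.ne', one_mul]
    _ ≤ g₀⁻¹ * ∫ x in ball x₀ (a * Real.sqrt (T - t)), ‖curl (u t) x‖ ^ 2 * G t x := by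
        refine mul_le_mul_of_nonneg_left ?_ (inv_nonneg.2 hg₀pos.le)
        refine setIntegral_mono_on (hI.const_mul g₀) hint.integrableOn measurableSet_ball fun x hx => ?_
        rw [mul_comm]
        exact mul_le_mul_of_nonneg_left (hGball x hx) (sq_nonneg _)
    _ ≤ g₀⁻¹ * ∫ x, ‖curl (u t) x‖ ^ 2 * G t x := by
        refine mul_le_mul_of_nonneg_left ?_ (inv_nonneg.2 hg₀pos.le)
        exact setIntegral_le_integral hint (Eventually.of_forall fun x =>
          mul_nonneg (sq_nonneg _) (hGnn x))
    _ = _ := by rw [hg₀inv, adaptedEnstrophy_apply]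

/-! ### Finite enstrophy of the classical Leray–Hopf solution at every time `0 < t < T` -/

/-- **Weighted enstrophy integrals are finite** for a classical Leray–Hopf solution from a
rapidly decaying datum: for `0 < t < T` and a bounded continuous weight `g`,
`x ↦ ‖curl u(t, x)‖² g(x)` is integrable on `ℝ³` (Tao 2013: all Sobolev norms of `u` are bounded
on the closed slab `[0, (t+T)/2]`, `tao2011_hasBoundedSobolevNormsOn_holds`; `‖curl v‖ ≤ ‖curlCLM‖ ‖Dv‖`).
[cite: Tao2011, Cor. 11.1 + Cor. 4.3 + Thm. 5.4 (iv)] -/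
theorem pinchingLower_integrable_enstrophy_mul {ν T : ℝ}
    {u : ℝ → EuclideanSpace ℝ (Fin 3) → EuclideanSpace ℝ (Fin 3)} {p : ℝ → EuclideanSpace ℝ (Fin 3) → ℝ}
    (hν : 0 < ν) (hsol : IsClassicalNSSolutionOn (Ico 0 T) ν 0 u p)
    (hLH : IsLerayHopfOn T ν 0 (u 0) u) (h₀ : HasRapidSpatialDecay (u 0)) {t : ℝ} (ht : t ∈ Ioo 0 T)
    {g : EuclideanSpace ℝ (Fin 3) → ℝ} (hg : Continuous g) {B : ℝ} (hgB : ∀ x, |g x| ≤ B) :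
    Integrable (fun x => ‖curl (u t) x‖ ^ 2 * g x) := by
  set T₁ : ℝ := (t + T) / 2 with hT₁
  have hT₁0 : 0 < T₁ := by rw [hT₁]; linarith [ht.1, ht.2]
  have hT₁T : T₁ < T := by rw [hT₁]; linarith [ht.2]
  have htT₁ : t ≤ T₁ := by rw [hT₁]; linarith [ht.2]
  have hsol' : IsClassicalNSSolutionOn (Icc 0 T₁) ν 0 u p :=
    hsol.mono (Icc_subset_Ico_right hT₁T) (uniqueDiffOn_Icc hT₁0)
  have hE' : ∃ C : NNReal, ∀ s ∈ Icc 0 T₁, ∫⁻ x, ‖u s x‖ₑ ^ 2 ≤ C :=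
    ⟨(2 * VectorCalculus.kineticEnergy (u 0)).toNNReal, fun s hs =>
      hLH.lintegral_enorm_sq_le hν.le ⟨hs.1, hs.2.trans hT₁T.le⟩⟩
  have hH : HasBoundedSobolevNormsOn (Icc 0 T₁) u :=
    tao2011_hasBoundedSobolevNormsOn_holds hν hT₁0 hsol' hE' h₀
  obtain ⟨C1, hC1⟩ := hH 1
  have hfin : ∫⁻ x, ‖iteratedFDeriv ℝ 1 (u t) x‖ₑ ^ 2 ≤ C1 := hC1 t ⟨ht.1.le, htT₁⟩
  have hsmooth : ContDiff ℝ 1 (u t) :=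
    (hsol.contDiff_velocity ⟨ht.1.le, ht.2⟩).of_le (by exact_mod_cast le_top)
  have hDc : Continuous (fderiv ℝ (u t)) := hsmooth.continuous_fderiv one_ne_zero
  -- `‖Du(t)‖² ∈ L¹`
  have hDint : Integrable (fun x => ‖fderiv ℝ (u t) x‖ ^ 2) := by
    refine ⟨(hDc.norm.pow 2).aestronglyMeasurable, ?_⟩
    rw [hasFiniteIntegral_iff_enorm]
    calc ∫⁻ x, ‖‖fderiv ℝ (u t) x‖ ^ 2‖ₑ = ∫⁻ x, ‖iteratedFDeriv ℝ 1 (u t) x‖ₑ ^ 2 := by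
          refine lintegral_congr fun x => ?_
          rw [← ofReal_norm (iteratedFDeriv ℝ 1 (u t) x), norm_iteratedFDeriv_one,
            Real.enorm_eq_ofReal (sq_nonneg _), ENNReal.ofReal_pow (norm_nonneg _)]
      _ ≤ C1 := hfin
      _ < ⊤ := ENNReal.coe_lt_top
  -- domination `‖curl u‖² |g| ≤ ‖curlCLM‖² B ‖Du‖²`
  have hωc : Continuous (curl (u t)) := continuous_curl hsmooth
  refine (hDint.const_mul (‖curlCLM‖ ^ 2 * B)).mono' ((hωc.norm.pow 2).mul hg).aestronglyMeasurable
    (Eventually.of_forall fun x => ?_)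
  rw [Real.norm_eq_abs, abs_mul, abs_of_nonneg (sq_nonneg _)]
  have h1 : ‖curl (u t) x‖ ≤ ‖curlCLM‖ * ‖fderiv ℝ (u t) x‖ := norm_curl_le _ _
  have h2 : ‖curl (u t) x‖ ^ 2 ≤ ‖curlCLM‖ ^ 2 * ‖fderiv ℝ (u t) x‖ ^ 2 := by
    rw [← mul_pow]; exact pow_le_pow_left₀ (norm_nonneg _) h1 2
  have hB0 : 0 ≤ B := (abs_nonneg _).trans (hgB x)
  calc ‖curl (u t) x‖ ^ 2 * |g x| ≤ (‖curlCLM‖ ^ 2 * ‖fderiv ℝ (u t) x‖ ^ 2) * B :=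
        mul_le_mul h2 (hgB x) (abs_nonneg _) (by positivity)
    _ = ‖curlCLM‖ ^ 2 * B * ‖fderiv ℝ (u t) x‖ ^ 2 := by ring

/-! ### Volume of balls and the one-time estimate -/

/-- Volume of balls in `ℝ³`: `|B(x, R)| = |B(0, 1)| R³`. [folklore] -/
theorem pinchingLower_measureReal_ball (x : EuclideanSpace ℝ (Fin 3)) {R : ℝ} (hR : 0 < R) :
    volume.real (ball x R) = volume.real (ball (0 : EuclideanSpace ℝ (Fin 3)) 1) * R ^ 3 := by
  rw [measureReal_def, Measure.addHaar_ball_of_pos volume x hR, finrank_euclideanSpace_fin,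
    ENNReal.toReal_mul, ENNReal.toReal_ofReal (by positivity), measureReal_def, mul_comm]

/-- **The one-time estimate.** For a smooth divergence-free `v` on `ℝ³` with `‖v‖ ≤ C/λ`, scales
`0 < ρ_c ≤ b ≤ a`, a Morrey bound `∫_{B(x₀,bλ)} ‖v‖² ≤ M bλ`, a local enstrophy bound
`∫_{B(x₀,3aλ)} ‖curl v‖² ≤ W` and the concentration `γ < ∫_{B(x₀,ρ_cλ)} ‖v‖³`, one has
`γ < 4 C ρ_c³ M / b² + 6 C (64 · 486 (1 + M_reg²) b² λ W + 576 |B₁| C₁² C² b⁵ / a²)`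
(`pinchingLower_sq_dist_average_le` on `B(x₀, bλ) ⊆ B(x₀, aλ)`, the mean bound
`pinchingLower_sq_norm_mul_measureReal_le` fed with the Morrey bound, and
`pinchingLower_cube_integral_le`). [folklore] -/
theorem pinchingLower_key_estimate : ∀ {v : EuclideanSpace ℝ (Fin 3) → EuclideanSpace ℝ (Fin 3)}, ContDiff ℝ (⊤ : ℕ∞) v → VectorCalculus.IsDivFree v → ∀ {x₀ : EuclideanSpace ℝ (Fin 3)} {C lam ρc b a M W γ : ℝ}, 0 ≤ C → 0 < lam → 0 < ρc → ρc ≤ b → b ≤ a → (∀ y, ‖v y‖ ≤ C / lam) → (∫ x in ball x₀ (b * lam), ‖v x‖ ^ 2) ≤ M * (b * lam) → (∫ x in ball x₀ (3 * a * lam), ‖curl v x‖ ^ 2) ≤ W → γ < (∫ x in ball x₀ (ρc * lam), ‖v x‖ ^ 3) → γ < 4 * C * ρc ^ 3 * M / b ^ 2 + 6 * C * (64 * (486 * (1 + regLaplacianMass ^ 2)) * b ^ 2 * lam * W + 576 * volume.real (ball (0 : EuclideanSpace ℝ (Fin 3)) 1) * lamGradL1 ^ 2 * C ^ 2 * b ^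 5 / a ^ 2) := by
  intro v hv hdiv x₀ C lam ρc b a M W γ hC hlam hρc hbρ hab hs hMor hW hγ
  have hbpos : 0 < b := lt_of_lt_of_le hρc hbρ
  have hapos : 0 < a := lt_of_lt_of_le hbpos hab
  have hcont : Continuous v := hv.continuous
  obtain ⟨P, hP⟩ : ∃ P : ℝ, P = 486 * (1 + regLaplacianMass ^ 2) := ⟨_, rfl⟩
  obtain ⟨V₁, hV₁⟩ : ∃ V₁ : ℝ, V₁ = volume.real (ball (0 : EuclideanSpace ℝ (Fin 3)) 1) := ⟨_, rfl⟩
  have hV₁pos : 0 < V₁ := by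
    rw [hV₁, measureReal_def]
    exact ENNReal.toReal_pos (measure_ball_pos volume _ one_pos).ne' measure_ball_lt_top.ne
  rw [← hP, ← hV₁]
  have hM : 0 ≤ M := by
    have h0 : 0 ≤ ∫ x in ball x₀ (b * lam), ‖v x‖ ^ 2 := integral_nonneg fun _ => sq_nonneg _
    exact nonneg_of_mul_nonneg_left (h0.trans hMor) (by positivity)
  have hW0 : 0 ≤ W := (integral_nonneg fun _ => sq_nonneg _).trans hW
  -- (2) near-constancy on `B(x₀, bλ)`
  obtain ⟨m, hm⟩ : ∃ m : EuclideanSpace ℝ (Fin 3), m = ⨍ y in ball x₀ (b * lam), v y := ⟨_, rfl⟩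
  obtain ⟨E, hE⟩ : ∃ E : ℝ, E = ∫ x in ball x₀ (b * lam), ‖v x - m‖ ^ 2 := ⟨_, rfl⟩
  obtain ⟨X, hX⟩ : ∃ X : ℝ, X = 64 * P * b ^ 2 * lam * W + 576 * V₁ * lamGradL1 ^ 2 * C ^ 2 *
    b ^ 5 / a ^ 2 := ⟨_, rfl⟩
  have hX0 : 0 ≤ X := by rw [hX, hP]; positivity
  have hEle : E ≤ lam * X := by
    have hρr : b * lam ≤ a * lam := mul_le_mul_of_nonneg_right hab hlam.le
    have h1 := pinchingLower_sq_dist_average_le hv hdiv hs x₀ (mul_pos hbpos hlam) hρr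
    rw [← hm, ← hE, show 3 * (a * lam) = 3 * a * lam by ring,
      pinchingLower_measureReal_ball x₀ (mul_pos hbpos hlam), ← hV₁, ← hP] at h1
    have h3 : 64 * (b * lam) ^ 2 * (P * W + V₁ * (b * lam) ^ 3 *
        (3 * lamGradL1 * (a * lam)⁻¹ * (C / lam)) ^ 2) = lam * X := by
      rw [hX]; field_simp; ring
    calc E ≤ _ := h1
      _ ≤ 64 * (b * lam) ^ 2 * (P * W + V₁ * (b * lam) ^ 3 *
          (3 * lamGradL1 * (a * lam)⁻¹ * (C / lam)) ^ 2) := by rw [hP]; gcongr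
      _ = lam * X := h3
  -- (3) the mean is small (Morrey)
  obtain ⟨Q, hQ⟩ : ∃ Q : ℝ, Q = ‖m‖ ^ 2 * V₁ * lam ^ 3 := ⟨_, rfl⟩
  have hQb : Q * b ^ 3 ≤ lam * (2 * M * b + 2 * X) := by
    have h1 := pinchingLower_sq_norm_mul_measureReal_le hcont x₀ (b * lam) m
    rw [pinchingLower_measureReal_ball x₀ (mul_pos hbpos hlam), ← hV₁, ← hE] at h1
    calc Q * b ^ 3 = ‖m‖ ^ 2 * (V₁ * (b * lam) ^ 3) := by rw [hQ]; ring
      _ ≤ 2 * (∫ x in ball x₀ (b * lam), ‖v x‖ ^ 2) + 2 * E := h1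
      _ ≤ 2 * (M * (b * lam)) + 2 * (lam * X) := by gcongr
      _ = lam * (2 * M * b + 2 * X) := by ring
  have hQρ : Q * ρc ^ 3 ≤ lam * (2 * M * ρc ^ 3 / b ^ 2 + 2 * X) := by
    have hq : ρc ^ 3 / b ^ 3 ≤ 1 := by
      rw [div_le_one (by positivity)]
      exact pow_le_pow_left₀ hρc.le hbρ 3
    calc Q * ρc ^ 3 = Q * b ^ 3 * (ρc ^ 3 / b ^ 3) := by field_simp
      _ ≤ lam * (2 * M * b + 2 * X) * (ρc ^ 3 / b ^ 3) :=
          mul_le_mul_of_nonneg_right hQb (by positivity)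
      _ = lam * (2 * M * ρc ^ 3 / b ^ 2) + lam * (2 * X) * (ρc ^ 3 / b ^ 3) := by
          field_simp
      _ ≤ lam * (2 * M * ρc ^ 3 / b ^ 2) + lam * (2 * X) * 1 := by gcongr
      _ = lam * (2 * M * ρc ^ 3 / b ^ 2 + 2 * X) := by ring
  -- (4) the cubic integral
  have hcube := pinchingLower_cube_integral_le hcont hs x₀
    (mul_le_mul_of_nonneg_right hbρ hlam.le) m
  rw [pinchingLower_measureReal_ball x₀ (mul_pos hρc hlam), ← hV₁, ← hE] at hcube
  calc γ < ∫ x in ball x₀ (ρc * lam), ‖v x‖ ^ 3 := hγ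
    _ ≤ C / lam * (2 * ‖m‖ ^ 2 * (V₁ * (ρc * lam) ^ 3) + 2 * E) := hcube
    _ = C / lam * (2 * (Q * ρc ^ 3) + 2 * E) := by rw [hQ]; ring
    _ ≤ C / lam * (2 * (lam * (2 * M * ρc ^ 3 / b ^ 2 + 2 * X)) + 2 * (lam * X)) := by gcongr
    _ = 4 * C * ρc ^ 3 * M / b ^ 2 + 6 * C * X := by field_simp; ring
    _ = _ := by rw [hX]

end Summit.NavierStokesRegularity.NavierStokesRegularity.Theorems.AdaptedFrequencyConverges.TauberianOmegaLimit

end
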